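import Mathlib
import Summits.Ventures.HodgeRepro.Tier4.Line1.InnerCalculus
import Summits.Ventures.HodgeRepro.Tier4.Line1.SecondCountableGA
import Summits.Ventures.HodgeRepro.Tier4.Line4.RieszOnSetting
import Summits.Ventures.HodgeRepro.Tier4.Line4.AdaptedONBConj

/-!
# Tier4/Line4/VanishingOfOrthogonal — `R(f)` kills every vector orthogonal to a subspace into which its adjoint
`R(f*)` maps: the clause `hvan` of the L4 wall's residual (b′) from the adjoint identity alone

Blind re-derivation cell `pub-hodge-repro`, Tier 4 «prove the step» (README §9–§10), seat t4-L4-p2 (prover, LINE L4,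
gen 3; bus S13737 / S13854). Tree path `lean/Summits/Ventures/HodgeRepro/Tier4/Line4/VanishingOfOrthogonal.lean`.
Mathlib-level (a two-line consequence of L1's adjoint identity); no literature.

WHAT IS PROVED.  On any `RTF.Setting` (L1, second countable `G`, countable `G(k)`): if `V` is an invariant subspace,
`f` a test function, `Vτ` ANY set of functions such that the adjoint `R(f*) = R(cj (refl f))` maps `V` into `Vτ`, and
`φ ∈ V` is orthogonal (for the setting's pairing over `D_G`) to every member of `Vτ`, then `R(f) φ = 0`
(`R_eq_zero_of_inner_eq_zero`): `⟨R(f)φ, R(f)φ⟩ = ⟨φ, R(f*) R(f) φ⟩ = 0` (`inner_R_eq_inner_R_adj`, L1's R-C) and a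
continuous invariant function of zero norm on `D_G` vanishes (`eq_zero_of_inner_self_eq_zero`, L1's R-A′).  On typer-2's
`Setting.ofAdelicData` this is the residual clause `hvan` of t4-L4-p1's `W3OfAdapted2.mixed_two_torus_W3_of_adapted'`
(«`R(f̄₁)` kills the conjugate of every vector of a constituent orthogonal to its `K`-type space»), in the two shapes
`rightRegular_eq_zero_of_orthogonal` (`R(f₁) ψ = 0`) and `rightRegular_cj_conj_eq_zero_of_orthogonal`
(`R(f̄₁)(conj ∘ ψ) = 0`, through L4-p1's `R_conj`), with the `K`-type space left ABSTRACT (`Vτ`): the only input is that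
`R(f₁*)` maps the constituent into `Vτ` — for `Vτ` the `K`-type space of the reading of record this is L4-p1's
`KTypeTransport.rightRegular_mem_kTypeSpace` (re-landed on that reading) applied to `f₁* = cj (refl f₁)`, i.e. the
RIGHT-equivariance of `f₁` under the local torus and the level (`f₁ (y κ) = conj (weight κ) · f₁ y`, `f₁ (y κ) = f₁ y`
for `κ ∈ K`) — a class of test functions typer-2's `Common/KTypeProjector` (`kProj`, S13782) produces from any test
function.  No projector identity, no harmonic analysis on the compact tori and no closure of the constituent under
averaging is needed for `hvan` — only the adjoint identity, which is in the tree.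

WHAT IS NOT HERE: `ha`/`hb` (one scalar per `K`-type space: multiplicity one, L4-p1's
`exists_scalar_conj_of_le_span_singleton`), `hadm`, `hfin` (Harish-Chandra, printed) and `hJ` (the weak W5 for the pair).

Nothing here says anything about the status of the Hodge conjecture for CM abelian varieties, which is NOT proved
(HC_CM is NOT proved by anyone in this repository).
-/

set_option autoImplicit false

noncomputable section

namespace Summit.Ventures.HodgeRepro.Tier4.Line4

open Summit.Ventures.HodgeRepro.Tier4.Common Summit.Ventures.HodgeRepro.Tier4.Line1
  Summit.Ventures.HodgeRepro.Tier4.Line1.RTF MeasureTheory NumberField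
open scoped ComplexConjugate

section Generic

variable {G : Type} [Group G] [TopologicalSpace G] [IsTopologicalGroup G] [MeasurableSpace G] [BorelSpace G]
  [SecondCountableTopology G] (S : RTF.Setting G) [Countable S.Gk]

/-- **`R(f)` kills the orthogonal complement of any space into which `R(f*)` maps**: for `V` invariant, `f` a test
function, `Vτ` with `R(cj (refl f)) '' V ⊆ Vτ`, and `φ ∈ V` orthogonal to `Vτ`, `R(f) φ = 0`. -/
theorem R_eq_zero_of_inner_eq_zero {V : Set (G → ℂ)} (hV : S.IsInvariantSubspace V) {Vτ : Set (G → ℂ)}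
    {f : G → ℂ} (hf : IsTest f) (hadj : ∀ ψ ∈ V, S.R (cj (refl f)) ψ ∈ Vτ) {φ : G → ℂ} (hφ : φ ∈ V)
    (hperp : ∀ ψ ∈ Vτ, S.inner φ ψ = 0) : S.R f φ = 0 := by
  have hθ : S.R f φ ∈ V := hV.conv φ hφ f hf
  have h1 : S.inner (S.R f φ) (S.R f φ) = S.inner φ (S.R (cj (refl f)) (S.R f φ)) :=
    S.inner_R_eq_inner_R_adj hf (hV.inv φ hφ) (hV.cont φ hφ) (hV.inv _ hθ) (hV.cont _ hθ)
  rw [hperp _ (hadj _ hθ)] at h1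
  exact S.eq_zero_of_inner_self_eq_zero (hV.inv _ hθ) (hV.cont _ hθ) h1

end Generic

section Adelic

variable {k : Type} [Field k] [NumberField k] (W : PlaneData k) [MeasurableSpace (GA W)] [BorelSpace (GA W)]
  (R : RTFData W) (μ : Measure (GA W)) [μ.IsHaarMeasure] [R.μT.IsHaarMeasure] [R.μT'.IsHaarMeasure]
  (DG : Set (GA W)) (fdG : IsFundamentalDomain (rationalPoints W) DG μ) (compG : IsCompact (closure DG))
  (compT : IsCompact (closure R.DT)) (compT' : IsCompact (closure R.DT'))

/-- **`R(f₁) ψ = 0` for `ψ` in a constituent orthogonal to `Vτ`**, as soon as `R(f₁*)` maps the constituent into `Vτ`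
(on typer-2's `Setting.ofAdelicData`; `Vτ` = the `K`-type space of the reading of record, left abstract). -/
theorem rightRegular_eq_zero_of_orthogonal {U : Set (GA W → ℂ)}
    (hU : (Setting.ofAdelicData W R μ DG fdG compG compT compT').IsInvariantSubspace U)
    {Vτ : Set (GA W → ℂ)} {f₁ : GA W → ℂ} (h₁ : IsTestFn W f₁)
    (hadj : ∀ ψ ∈ U, rightRegular W μ (RTF.cj (RTF.refl f₁)) ψ ∈ Vτ) {ψ : GA W → ℂ} (hψ : ψ ∈ U)
    (hperp : ∀ w ∈ Vτ, (Setting.ofAdelicData W R μ DG fdG compG compT compT').inner ψ w = 0) :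
    rightRegular W μ f₁ ψ = 0 := by
  haveI := secondCountable_GA W
  haveI : Countable (Setting.ofAdelicData W R μ DG fdG compG compT compT').Gk := countable_rationalPoints W
  exact R_eq_zero_of_inner_eq_zero (Setting.ofAdelicData W R μ DG fdG compG compT compT') hU ⟨h₁.1, h₁.2⟩ hadj
    hψ hperp

/-- **The clause `hvan` of `W3OfAdapted2.mixed_two_torus_W3_of_adapted'`** (`R(f̄₁)` kills the conjugate of every vector
of a constituent orthogonal to `Vτ`), from the same single input (`R(f₁*)` maps the constituent into `Vτ`), through
L4-p1's `R_conj`. -/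
theorem rightRegular_cj_conj_eq_zero_of_orthogonal {U : Set (GA W → ℂ)}
    (hU : (Setting.ofAdelicData W R μ DG fdG compG compT compT').IsInvariantSubspace U)
    {Vτ : Set (GA W → ℂ)} {f₁ : GA W → ℂ} (h₁ : IsTestFn W f₁)
    (hadj : ∀ ψ ∈ U, rightRegular W μ (RTF.cj (RTF.refl f₁)) ψ ∈ Vτ) {ψ : GA W → ℂ} (hψ : ψ ∈ U)
    (hperp : ∀ w ∈ Vτ, (Setting.ofAdelicData W R μ DG fdG compG compT compT').inner ψ w = 0) :
    rightRegular W μ (RTF.cj f₁) (fun x => conj (ψ x)) = fun _ => 0 := by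
  have h := R_conj (Setting.ofAdelicData W R μ DG fdG compG compT compT') (RTF.cj f₁) ψ
  have hcj : RTF.cj (RTF.cj f₁) = f₁ := by
    funext y
    simp [RTF.cj]
  rw [hcj] at h
  have h0 := rightRegular_eq_zero_of_orthogonal W R μ DG fdG compG compT compT' hU h₁ hadj hψ hperp
  show (Setting.ofAdelicData W R μ DG fdG compG compT compT').R (RTF.cj f₁) (fun x => conj (ψ x)) = fun _ => 0
  rw [h]
  funext x
  have : (Setting.ofAdelicData W R μ DG fdG compG compT compT').R f₁ ψ x = 0 := by
    have := congrFun h0 x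
    exact this
  simp [this]

end Adelic

end Summit.Ventures.HodgeRepro.Tier4.Line4

end
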